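import Summits.Schanuel.Schanuel.Theorems.ZilberEacConicSheetRelation
import HarnessLib

/-!
# Arbitrary base branches, LVIII (a): the RATIONAL sheet norm over a conic — transcendence of the
# relation `y₁ = f·θ'e^{η}` for a rational fibre value `f`

HONEST FRAMING.  Cell `pub-schanuel` (Zilber's Exponential-Algebraic Closedness, case ladder;
host summit Schanuel), seat 2, gen 30.  File L decided every POLYNOMIAL fibre over a conic by the
sheet norm; here the norm is taken of the homogenised substitution
`E(x, z, Y) = Σ_j h_j(x)(A + zB)^j(A' + zB')^{d−j}Y^j` (`d = deg_Y H`), so that a relation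
`H(x₀, f·θ'e^{η}) = 0` for the RATIONAL fibre value `f = (A + x₁B)/(A' + x₁B')` again yields
`Hn(x₀, θ'e^{η}) = 0` with `Hn ≠ 0` (**`exists_sheetNorm₃`**, **`sheetNorm₃_ne_zero`**), contradicting
file XLIII.  Result: **`unprojectedDense_conic_rationalFibre`** — for `P` monic quadratic with simple
roots and `(A, B), (A', B') ≠ (0, 0)`, every irreducible surface `S` of dimension `≤ 2` containing the
graph of `(A + x₁B)/(A' + x₁B')` over the conic (off the poles) has Zariski-dense exponential points;
**`unprojectedDense_conic_rationalFibreMv`** — the same for `R/Q` with `R, Q ∈ ℂ[x₀, x₁]` nonzero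
somewhere on the conic.  With files LVI–LVII: the graph of EVERY nonzero rational function over every
cyclic cover `x₁^k = P(x₀)` is covered except `k = 2`, `deg P ≡ 2 (mod 4)`, `deg P ≥ 6` (O86).
Decided instances of an OPEN question (Mantova–Masser, PLMS 2024 §1 p. 5); EC(3,2) OPEN; NOT
Schanuel's conjecture (neither used nor implied); EAC ⇏ SC.
-/

noncomputable section

open Filter Topology Set Complex Polynomial
open Literature.NumberTheory.Transcendental Literature.ModelTheory.Zilber
open Literature.ModelTheory.ExponentialFields

set_option linter.dupNamespace false

namespace Summit.Schanuel.Schanuel.Theorems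

section RationalNorm

variable (P A B A' B' : ℂ[X])

/-! ## Part A. The sheet norm of a general `E ∈ ℂ[x][Y][z]` -/

/-- **The sheet norm of `E ∈ ℂ[x][Y][z]`**: a polynomial `Hn ∈ ℂ[x][Y]` with
`Hn(x, y) = E(x, y, z)·E(x, y, −z)` whenever `z² = P(x)` (reduce `E` modulo the monic `z² − P`).
[folklore] -/
theorem exists_sheetNorm₃ (E : ℂ[X][X][X]) : ∃ Hn : ℂ[X][X], ∀ x z y : ℂ, z ^ 2 = P.eval x →
    (Hn.map (Polynomial.evalRingHom x)).eval y =
      E.eval₂ (Polynomial.eval₂RingHom (Polynomial.evalRingHom x) y) z *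
        E.eval₂ (Polynomial.eval₂RingHom (Polynomial.evalRingHom x) y) (-z) := by
  classical
  set q : ℂ[X][X][X] := X ^ 2 - C (C P) with hq
  have hqm : q.Monic := by rw [hq]; exact Polynomial.monic_X_pow_sub_C _ two_ne_zero
  have hqdeg : q.natDegree = 2 := by rw [hq]; exact Polynomial.natDegree_X_pow_sub_C
  have hq1 : q ≠ 1 := by
    intro h
    have := congrArg Polynomial.natDegree h
    rw [hqdeg, Polynomial.natDegree_one] at this
    exact absurd this (by norm_num)
  set Er : ℂ[X][X][X] := E %ₘ q with hEr
  have hEr1 : Er.natDegree ≤ 1 := by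
    have := Polynomial.natDegree_modByMonic_lt E hqm hq1
    rw [hqdeg, ← hEr] at this
    omega
  have hErXC : Er = C (Er.coeff 1) * X + C (Er.coeff 0) := Polynomial.eq_X_add_C_of_natDegree_le_one hEr1
  refine ⟨Er.coeff 0 ^ 2 - C P * Er.coeff 1 ^ 2, fun x z y hz => ?_⟩
  set evK : ℂ[X][X] →+* ℂ := Polynomial.eval₂RingHom (Polynomial.evalRingHom x) y with hevKdef
  have hevK : ∀ F : ℂ[X][X], evK F = (F.map (Polynomial.evalRingHom x)).eval y := fun F => by
    rw [hevKdef, Polynomial.coe_eval₂RingHom, Polynomial.eval_map]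
  have hevKC : ∀ p : ℂ[X], evK (C p) = p.eval x := fun p => by
    rw [hevK, Polynomial.map_C, Polynomial.eval_C, Polynomial.coe_evalRingHom]
  have key : ∀ z' : ℂ, z' ^ 2 = P.eval x →
      evK (Er.coeff 0) + z' * evK (Er.coeff 1) = E.eval₂ evK z' := by
    intro z' hz'
    set ev : ℂ[X][X][X] →+* ℂ := Polynomial.eval₂RingHom evK z' with hev
    have hevC : ∀ F : ℂ[X][X], ev (C F) = evK F := fun F => by
      rw [hev, Polynomial.coe_eval₂RingHom, Polynomial.eval₂_C]
    have hevX : ev X = z' := by rw [hev, Polynomial.coe_eval₂RingHom, Polynomial.eval₂_X]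
    have hevq : ev q = 0 := by
      rw [hq, map_sub ev, map_pow ev, hevX, hevC, hevKC, hz', sub_self]
    have hevE : ev E = E.eval₂ evK z' := by rw [hev, Polynomial.coe_eval₂RingHom]
    have hevEr : ev Er = evK (Er.coeff 0) + z' * evK (Er.coeff 1) := by
      rw [hErXC, map_add ev, map_mul ev, hevC, hevC, hevX]
      simp only [Polynomial.coeff_add, Polynomial.coeff_C_mul, Polynomial.coeff_X_one,
        Polynomial.coeff_X_zero, Polynomial.coeff_C_zero, Polynomial.coeff_C_succ, mul_one,
        mul_zero, add_zero, zero_add]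
      ring
    have hsplit : ev E = ev Er + ev q * ev (E /ₘ q) := by
      rw [← map_mul ev, ← map_add ev, hEr, Polynomial.modByMonic_add_div]
    rw [← hevE, hsplit, hevq, zero_mul, add_zero, hevEr]
  have hneg : (-z) ^ 2 = P.eval x := by rw [neg_sq]; exact hz
  have k1 := key z hz
  have k2 := key (-z) hneg
  rw [← hevK, map_sub evK, map_mul evK, map_pow evK, map_pow evK, hevKC, ← k1, ← k2, ← hz]
  ring

/-! ## Part B. The homogenised substitution for a rational fibre value -/

/-- Evaluation of the homogenised substitution
`E = Σ_j h_j(x)(A + zB)^j(A' + zB')^{d−j}Y^j`: for `A'(x) + zB'(x) ≠ 0` it equals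
`(A' + zB')^d · H(x, ((A + zB)/(A' + zB'))·y)`. [folklore] -/
theorem eval_homSubst (H : ℂ[X][X]) (x z y : ℂ) (hden : A'.eval x + z * B'.eval x ≠ 0) :
    (∑ j ∈ Finset.range (H.natDegree + 1),
        (C (C (H.coeff j)) * (C (C A) + X * C (C B)) ^ j * (C (C A') + X * C (C B')) ^ (H.natDegree - j) *
          C (X : ℂ[X][X]) ^ j : ℂ[X][X][X])).eval₂
        (Polynomial.eval₂RingHom (Polynomial.evalRingHom x) y) z =
      (A'.eval x + z * B'.eval x) ^ H.natDegree *
        (H.map (Polynomial.evalRingHom x)).eval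
          ((A.eval x + z * B.eval x) / (A'.eval x + z * B'.eval x) * y) := by
  set evK : ℂ[X][X] →+* ℂ := Polynomial.eval₂RingHom (Polynomial.evalRingHom x) y with hevKdef
  set ev : ℂ[X][X][X] →+* ℂ := Polynomial.eval₂RingHom evK z with hev
  have hevC : ∀ F : ℂ[X][X], ev (C F) = evK F := fun F => by
    rw [hev, Polynomial.coe_eval₂RingHom, Polynomial.eval₂_C]
  have hevX : ev X = z := by rw [hev, Polynomial.coe_eval₂RingHom, Polynomial.eval₂_X]
  have hevKC : ∀ p : ℂ[X], evK (C p) = p.eval x := fun p => by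
    rw [hevKdef, Polynomial.coe_eval₂RingHom, Polynomial.eval₂_C, Polynomial.coe_evalRingHom]
  have hevKX : evK X = y := by rw [hevKdef, Polynomial.coe_eval₂RingHom, Polynomial.eval₂_X]
  change ev _ = _
  rw [map_sum ev, Polynomial.eval_map, Polynomial.eval₂_eq_sum_range, Finset.mul_sum]
  refine Finset.sum_congr rfl fun j hj => ?_
  have hjd : j ≤ H.natDegree := by
    have := Finset.mem_range.1 hj
    omega
  rw [map_mul ev, map_mul ev, map_mul ev, map_pow ev, map_pow ev, map_pow ev, map_add ev, map_add ev,
    map_mul ev, map_mul ev, hevX, hevC, hevC, hevC, hevC, hevC, hevC, hevKC, hevKC, hevKC, hevKC,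
    hevKC, hevKX, Polynomial.coe_evalRingHom, mul_pow, div_pow,
    ← pow_sub_mul_pow (A'.eval x + z * B'.eval x) hjd]
  field_simp

/-- **The sheet norm of the homogenised substitution**: `Hn(x, y) = E(x, y, z)E(x, y, −z)` on the
curve. [folklore] -/
theorem exists_sheetNorm_rational (H : ℂ[X][X]) : ∃ Hn : ℂ[X][X], ∀ x z y : ℂ, z ^ 2 = P.eval x →
    A'.eval x + z * B'.eval x ≠ 0 → A'.eval x - z * B'.eval x ≠ 0 →
    (Hn.map (Polynomial.evalRingHom x)).eval y =
      ((A'.eval x + z * B'.eval x) ^ H.natDegree *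
        (H.map (Polynomial.evalRingHom x)).eval
          ((A.eval x + z * B.eval x) / (A'.eval x + z * B'.eval x) * y)) *
      ((A'.eval x - z * B'.eval x) ^ H.natDegree *
        (H.map (Polynomial.evalRingHom x)).eval
          ((A.eval x - z * B.eval x) / (A'.eval x - z * B'.eval x) * y)) := by
  obtain ⟨Hn, hHn⟩ := exists_sheetNorm₃ P
    (∑ j ∈ Finset.range (H.natDegree + 1),
      (C (C (H.coeff j)) * (C (C A) + X * C (C B)) ^ j * (C (C A') + X * C (C B')) ^ (H.natDegree - j) *
        C (X : ℂ[X][X]) ^ j : ℂ[X][X][X]))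
  refine ⟨Hn, fun x z y hz hd₁ hd₂ => ?_⟩
  have hd₂' : A'.eval x + -z * B'.eval x ≠ 0 := by rw [neg_mul, ← sub_eq_add_neg]; exact hd₂
  rw [hHn x z y hz, eval_homSubst A B A' B' H x z y hd₁, eval_homSubst A B A' B' H x (-z) y hd₂']
  simp only [neg_mul, ← sub_eq_add_neg]

/-- **Non-vanishing of the rational sheet norm.**  `A² − PB² ≠ 0`, `A'² − PB'² ≠ 0`, `H ≠ 0`
⟹ `Hn ≠ 0`. [folklore] -/
theorem sheetNorm_rational_ne_zero (hN : A ^ 2 - P * B ^ 2 ≠ 0) (hN' : A' ^ 2 - P * B' ^ 2 ≠ 0)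
    (H : ℂ[X][X]) (hH : H ≠ 0) {Hn : ℂ[X][X]}
    (hHn : ∀ x z y : ℂ, z ^ 2 = P.eval x → A'.eval x + z * B'.eval x ≠ 0 →
      A'.eval x - z * B'.eval x ≠ 0 →
      (Hn.map (Polynomial.evalRingHom x)).eval y =
        ((A'.eval x + z * B'.eval x) ^ H.natDegree *
          (H.map (Polynomial.evalRingHom x)).eval
            ((A.eval x + z * B.eval x) / (A'.eval x + z * B'.eval x) * y)) *
        ((A'.eval x - z * B'.eval x) ^ H.natDegree *
          (H.map (Polynomial.evalRingHom x)).eval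
            ((A.eval x - z * B.eval x) / (A'.eval x - z * B'.eval x) * y))) :
    Hn ≠ 0 := by
  classical
  intro hHn0
  obtain ⟨j, hj⟩ := Polynomial.support_nonempty.2 hH
  have hj' : H.coeff j ≠ 0 := Polynomial.mem_support_iff.1 hj
  have hprod : (A ^ 2 - P * B ^ 2) * (A' ^ 2 - P * B' ^ 2) * H.coeff j ≠ 0 :=
    mul_ne_zero (mul_ne_zero hN hN') hj'
  obtain ⟨x, hx⟩ : ∃ x, ((A ^ 2 - P * B ^ 2) * (A' ^ 2 - P * B' ^ 2) * H.coeff j).eval x ≠ 0 := by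
    by_contra hall
    push Not at hall
    exact hprod (Polynomial.funext (by simpa using hall))
  rw [Polynomial.eval_mul, Polynomial.eval_mul] at hx
  have hNx : (A ^ 2 - P * B ^ 2).eval x ≠ 0 := left_ne_zero_of_mul (left_ne_zero_of_mul hx)
  have hN'x : (A' ^ 2 - P * B' ^ 2).eval x ≠ 0 := right_ne_zero_of_mul (left_ne_zero_of_mul hx)
  have hjx : (H.coeff j).eval x ≠ 0 := right_ne_zero_of_mul hx
  obtain ⟨z, hz⟩ := IsAlgClosed.exists_pow_nat_eq (P.eval x) two_pos
  have hlam : (A.eval x + z * B.eval x) * (A.eval x - z * B.eval x) ≠ 0 := by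
    rw [sheet_mul_sheet_eq P A B hz]; exact hNx
  have hden : (A'.eval x + z * B'.eval x) * (A'.eval x - z * B'.eval x) ≠ 0 := by
    rw [sheet_mul_sheet_eq P A' B' hz]; exact hN'x
  set Hx : ℂ[X] := H.map (Polynomial.evalRingHom x) with hHxdef
  have hHx : Hx ≠ 0 := by
    intro h0
    apply hjx
    have := congrArg (fun p : ℂ[X] => p.coeff j) h0
    simpa [hHxdef, Polynomial.coeff_map] using this
  set l₁ : ℂ := (A.eval x + z * B.eval x) / (A'.eval x + z * B'.eval x) with hl₁
  set l₂ : ℂ := (A.eval x - z * B.eval x) / (A'.eval x - z * B'.eval x) with hl₂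
  have hl₁0 : l₁ ≠ 0 := div_ne_zero (left_ne_zero_of_mul hlam) (left_ne_zero_of_mul hden)
  have hl₂0 : l₂ ≠ 0 := div_ne_zero (right_ne_zero_of_mul hlam) (right_ne_zero_of_mul hden)
  set Pr : ℂ[X] := (C ((A'.eval x + z * B'.eval x) ^ H.natDegree) * Hx.comp (C l₁ * X)) *
    (C ((A'.eval x - z * B'.eval x) ^ H.natDegree) * Hx.comp (C l₂ * X)) with hPr
  have hPr0 : Pr = 0 := by
    refine Polynomial.funext fun y => ?_
    have h := hHn x z y hz (left_ne_zero_of_mul hden) (right_ne_zero_of_mul hden)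
    rw [hHn0, Polynomial.map_zero, Polynomial.eval_zero] at h
    simp only [hPr, Polynomial.eval_mul, Polynomial.eval_C, Polynomial.eval_comp, Polynomial.eval_X,
      Polynomial.eval_zero]
    rw [h]
  have hcomp : ∀ lam : ℂ, lam ≠ 0 → Hx.comp (C lam * X) ≠ 0 := by
    intro lam hlam0 h0
    rw [Polynomial.comp_eq_zero_iff] at h0
    rcases h0 with h0 | ⟨-, h0⟩
    · exact hHx h0
    · have h1 := congrArg (fun p : ℂ[X] => p.coeff 1) h0
      simp only [Polynomial.coeff_C_mul, Polynomial.coeff_X_one, mul_one,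
        Polynomial.coeff_C_succ] at h1
      exact hlam0 h1
  rcases mul_eq_zero.1 hPr0 with h1 | h1
  · rcases mul_eq_zero.1 h1 with h2 | h2
    · rw [Polynomial.C_eq_zero] at h2
      exact (pow_ne_zero _ (left_ne_zero_of_mul hden)) h2
    · exact hcomp _ hl₁0 h2
  · rcases mul_eq_zero.1 h1 with h2 | h2
    · rw [Polynomial.C_eq_zero] at h2
      exact (pow_ne_zero _ (right_ne_zero_of_mul hden)) h2
    · exact hcomp _ hl₂0 h2

end RationalNorm

/-! ## Part C. Transcendence of the rational sheet relation -/

/-- **Transcendence of the rational sheet relation over a conic.**  `η` the small branch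
(`c = p₀ − p₁²/4 ≠ 0`), `θ' ≠ 0`, `A² − PB² ≠ 0`, `A'² − PB'² ≠ 0`: no nonzero `H` has
`H(1/u, f(u)·θ'e^{η(u)}) = 0` for all small `u ≠ 0`, `f = (A + x₁B)/(A' + x₁B')` along
`x₁(u) = 1/u + p₁/2 + η(u)`. [folklore] (new in this form) -/
theorem conic_exp_relation_transcendental_rational {p₁ p₀ θ' : ℂ} (hc : p₀ - p₁ ^ 2 / 4 ≠ 0)
    (hθ' : θ' ≠ 0) {η : ℂ → ℂ} (hηan : AnalyticAt ℂ η 0) (hη0 : η 0 = 0)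
    (hηQ : ∀ᶠ u in 𝓝 (0 : ℂ), u * η u ^ 2 + (2 + p₁ * u) * η u - (p₀ - p₁ ^ 2 / 4) * u = 0)
    {P A B A' B' : ℂ[X]} (hPev : ∀ x : ℂ, P.eval x = x ^ 2 + p₁ * x + p₀)
    (hN : A ^ 2 - P * B ^ 2 ≠ 0) (hN' : A' ^ 2 - P * B' ^ 2 ≠ 0) (H : ℂ[X][X]) (hH0 : H ≠ 0) :
    ¬ ∀ᶠ u in 𝓝[≠] (0 : ℂ), (H.map (Polynomial.evalRingHom u⁻¹)).eval
      ((A.eval u⁻¹ + (u⁻¹ + p₁ / 2 + η u) * B.eval u⁻¹) /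
        (A'.eval u⁻¹ + (u⁻¹ + p₁ / 2 + η u) * B'.eval u⁻¹) * (θ' * Complex.exp (η u))) = 0 := by
  intro h
  obtain ⟨Hn, hHn⟩ := exists_sheetNorm_rational P A B A' B' H
  have hHn0 : Hn ≠ 0 := sheetNorm_rational_ne_zero P A B A' B' hN hN' H hH0 hHn
  -- the denominator is nonzero on both sheets near `u = 0`
  obtain ⟨ψ₁, L₁, hψ₁an, hψ₁0, hf₁⟩ := exists_sheetFibre_normalForm hηan hηQ hPev hN'
  have hηan' : AnalyticAt ℂ (fun u => -(p₁ * u) - η u) 0 := by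
    have hid : AnalyticAt ℂ (fun u : ℂ => u) 0 := analyticAt_id
    exact (analyticAt_const.mul hid).neg.sub hηan
  -- the conjugate sheet `x₁' = −x₁ = 1/u + p₁/2 + η'(u)` with `η'(u) = −2/u − p₁ − η(u)`? No: use the
  -- value `A' − x₁B'` directly: it is the value on the sheet `−x₁`, and `(−x₁)² = P` as well, so the
  -- normal form lemma applies to `(A', −B')`.
  have hN'' : A' ^ 2 - P * (-B') ^ 2 ≠ 0 := by rw [neg_sq]; exact hN'
  obtain ⟨ψ₂, L₂, hψ₂an, hψ₂0, hf₂⟩ := exists_sheetFibre_normalForm hηan hηQ hPev hN''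
  have hψ₁ne : ∀ᶠ u in 𝓝 (0 : ℂ), ψ₁ u ≠ 0 := hψ₁an.continuousAt.eventually_ne hψ₁0
  have hψ₂ne : ∀ᶠ u in 𝓝 (0 : ℂ), ψ₂ u ≠ 0 := hψ₂an.continuousAt.eventually_ne hψ₂0
  refine conic_exp_relation_transcendental hc hθ' hηan hη0 hηQ Hn hHn0 ?_
  filter_upwards [h, eventually_nhdsWithin_of_eventually_nhds hηQ, hf₁, hf₂,
    eventually_nhdsWithin_of_eventually_nhds hψ₁ne, eventually_nhdsWithin_of_eventually_nhds hψ₂ne,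
    self_mem_nhdsWithin] with u hu hq hf₁u hf₂u hψ₁u hψ₂u hu0
  have hu0' : u ≠ 0 := hu0
  have hz := conic_sheet_sq hPev hu0' hq
  have hd₁ : A'.eval u⁻¹ + (u⁻¹ + p₁ / 2 + η u) * B'.eval u⁻¹ ≠ 0 := by
    rw [hf₁u]; exact mul_ne_zero hψ₁u (zpow_ne_zero _ hu0')
  have hd₂ : A'.eval u⁻¹ - (u⁻¹ + p₁ / 2 + η u) * B'.eval u⁻¹ ≠ 0 := by
    have : A'.eval u⁻¹ - (u⁻¹ + p₁ / 2 + η u) * B'.eval u⁻¹ =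
        A'.eval u⁻¹ + (u⁻¹ + p₁ / 2 + η u) * (-B').eval u⁻¹ := by
      rw [Polynomial.eval_neg]; ring
    rw [this, hf₂u]; exact mul_ne_zero hψ₂u (zpow_ne_zero _ hu0')
  rw [hHn _ _ _ hz hd₁ hd₂, hu, mul_zero, zero_mul]

end Summit.Schanuel.Schanuel.Theorems

end
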